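import Summits.AtomisticToContinuum.BoseEinsteinCondensation.Theses.BECStronglyRayleigh
import Literature.MathematicalPhysics.QuantumManyBody.BoseGasCatStates
import Literature.MathematicalPhysics.QuantumManyBody.PeriodicBoseGasThm31

/-!
# Negative lemmas for crux `LatticeToPeriodicBridge` (stmt-AtomisticToContinuum-9674), II:
the density threshold of the consequent is genuinely `v`-dependent

Supports stmt-AtomisticToContinuum-9674 (route `BECStronglyRayleigh`, rank 4; crux
`KineticLatticeBEC → PeriodicBEC`). The consequent quantifies `∀ v admissible, ∃ ρ₀ > 0, ∀ ρ < ρ₀ …`.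

* `periodicEnergy_hardCorePotential_eq_top`, `periodicGroundStateEnergy_hardCorePotential_eq_top`,
  `eventually_periodicGroundStateEnergy_hardCorePotential_eq_top` — the torus twins of the
  Dirichlet facts in `BoseGasThermodynamicLimitRuelle`: beyond `⌈2L/a⌉³` hard spheres of radius `a`
  do not fit in the fundamental cell (pigeonhole `exists_dist_lt_of_ceil_pow_lt_of_mem_cellN`), so
  `E₀^per = ⊤`, eventually along `L_N = (N/ρ)^{1/3}` for every `ρ > 8/a³` — and then EVERY periodic
  trial state is a `δ`-near-minimiser for every `δ`.
* `threshold_le_of_consequentAt_hardCorePotential` — TIGHTNESS of the quantifier order: any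
  threshold `ρ₀` witnessing the consequent for `hardCorePotential a` satisfies `ρ₀ ≤ 8/a³`
  (above it the fragmented cat states of `exists_fragmented_periodicTrialState`, `n₀ ≤ N/m³`, are
  near-minimisers).
* `not_uniformConsequent` — the NATURAL STRENGTHENING `∃ ρ₀ ∀ v` of the consequent (its body with
  `∃ ρ₀` moved in front of `∀ v`, spelled out inline) is false; `bridgeUniform_iff_not_kinetic` —
  the correspondingly strengthened bridge holds iff the lattice target fails (same pattern as the windowed bridges of part I,
  `Negative/WindowedBridge.lean`).

So a proof of the crux must let `ρ₀` depend on `v` at least through its hard-core radius / range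
(by scaling `v_R(r) = R⁻² v(r/R)`, `a(v_R) = R a(v)`, the threshold scales like `R⁻³` anyway; the
formal witness is the super-close-packed hard-sphere gas). No `def`; no statement of the route is
asserted. `[folklore]` throughout.
-/

noncomputable section

namespace Summit.AtomisticToContinuum.BoseEinsteinCondensation.Theorems.LatticeToPeriodicBridge.Negative

open Literature.MathematicalPhysics.QuantumManyBody.BoseGas
open _root_.MeasureTheory _root_.Filter _root_.Topology
open scoped ENNReal NNReal

open Summit.AtomisticToContinuum.BoseEinsteinCondensation.Theses
open Summit.AtomisticToContinuum.BoseEinsteinCondensation.Theses.BECStronglyRayleigh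

/-! ## Hard spheres beyond close packing on the torus: `E₀^per = ⊤` -/

/-- Pigeonhole in the CLOSED-OPEN cell `[0,L)³` (the torus fundamental domain): if
`N > ⌈2L/a⌉³`, every configuration in `cellN N L` has two particles at distance `< a`
(twin of `exists_dist_lt_of_ceil_pow_lt`, which is stated for the open Dirichlet box). [folklore] -/
theorem exists_dist_lt_of_ceil_pow_lt_of_mem_cellN {a : ℝ} (ha : 0 < a) {L : ℝ} {N : ℕ}
    (hN : ⌈2 * L / a⌉₊ ^ 3 < N) {X : Config N} (hX : X ∈ cellN N L) :
    ∃ i j : Fin N, i ≠ j ∧ dist (X i) (X j) < a := by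
  set m : ℕ := ⌈2 * L / a⌉₊ with hm
  have hcell : ∀ (i : Fin N) (k : Fin 3), ⌊2 * X i k / a⌋₊ < m := by
    intro i k
    have hx : X i k ∈ Set.Ico 0 L := hX i k
    rw [Nat.floor_lt (by have := hx.1; positivity)]
    calc 2 * X i k / a < 2 * L / a := by
          exact div_lt_div_of_pos_right (by linarith [hx.2]) ha
      _ ≤ m := Nat.le_ceil _
  let c : Fin N → Fin 3 → Fin m := fun i k => ⟨⌊2 * X i k / a⌋₊, hcell i k⟩
  have hcard : Fintype.card (Fin 3 → Fin m) < Fintype.card (Fin N) := by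
    simpa [Fintype.card_fun, Fintype.card_fin] using hN
  obtain ⟨i, j, hij, hc⟩ := Fintype.exists_ne_map_eq_of_card_lt c hcard
  refine ⟨i, j, hij, ?_⟩
  have hcoord : ∀ k : Fin 3, dist (X i k) (X j k) < a / 2 := by
    intro k
    have hk : ⌊2 * X i k / a⌋₊ = ⌊2 * X j k / a⌋₊ := by
      have := congr_fun hc k
      simpa [c, Fin.ext_iff] using this
    have hxi : X i k ∈ Set.Ico 0 L := hX i k
    have hxj : X j k ∈ Set.Ico 0 L := hX j k
    have hpi : 0 ≤ 2 * X i k / a := by have := hxi.1; positivity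
    have hpj : 0 ≤ 2 * X j k / a := by have := hxj.1; positivity
    have h1 := Nat.floor_le hpi
    have h2 := Nat.lt_floor_add_one (2 * X i k / a)
    have h3 := Nat.floor_le hpj
    have h4 := Nat.lt_floor_add_one (2 * X j k / a)
    rw [hk] at h1 h2
    have hlt : |2 * X i k / a - 2 * X j k / a| < 1 := by
      rw [abs_sub_lt_iff]; constructor <;> linarith
    rw [Real.dist_eq]
    have hrew : X i k - X j k = (a / 2) * (2 * X i k / a - 2 * X j k / a) := by
      field_simp
    rw [hrew, abs_mul, abs_of_pos (by positivity : (0 : ℝ) < a / 2)]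
    calc a / 2 * |2 * X i k / a - 2 * X j k / a| < a / 2 * 1 :=
          mul_lt_mul_of_pos_left hlt (by positivity)
      _ = a / 2 := mul_one _
  rw [EuclideanSpace.dist_eq, Real.sqrt_lt' ha]
  calc ∑ k, dist (X i k) (X j k) ^ 2 < ∑ _k : Fin 3, (a / 2) ^ 2 :=
        Finset.sum_lt_sum_of_nonempty Finset.univ_nonempty fun k _ =>
          pow_lt_pow_left₀ (hcoord k) dist_nonneg two_ne_zero
    _ = 3 * (a / 2) ^ 2 := by simp
    _ < a ^ 2 := by nlinarith

/-- **Too many hard spheres do not fit on the torus either**: if `N > ⌈2L/a⌉³`, every periodic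
trial state has infinite periodic energy for `hardCorePotential a` (already the nearest-image
term of `v^per` is `⊤` at every configuration of the fundamental cell). [folklore] -/
theorem periodicEnergy_hardCorePotential_eq_top {a : ℝ} (ha : 0 < a) {L : ℝ} {N : ℕ}
    (hN : ⌈2 * L / a⌉₊ ^ 3 < N) (Ψ : PeriodicTrialState N L) :
    periodicEnergy (hardCorePotential a) Ψ = ⊤ := by
  have hpt : ∀ X ∈ cellN N L, ⊤ * ((‖Ψ.ψ X‖₊ : ℝ≥0∞) ^ 2) ≤
      kineticDensity Ψ.ψ X +
        periodicInteraction (hardCorePotential a) L X * (‖Ψ.ψ X‖₊ : ℝ≥0∞) ^ 2 := by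
    intro X hX
    obtain ⟨i, j, hij, hd⟩ := exists_dist_lt_of_ceil_pow_lt_of_mem_cellN ha hN hX
    have htop : periodicInteraction (hardCorePotential a) L X = ⊤ := by
      refine eq_top_iff.2 ?_
      calc (⊤ : ℝ≥0∞) = interaction (hardCorePotential a) X :=
            (interaction_eq_top_of_apply_eq_top hij (hardCorePotential_of_lt hd)).symm
        _ ≤ periodicInteraction (hardCorePotential a) L X := interaction_le_periodicInteraction _ L X
    rw [htop]
    exact le_add_self
  have h1 : ∫⁻ X in cellN N L, ⊤ * ((‖Ψ.ψ X‖₊ : ℝ≥0∞) ^ 2) = ⊤ := by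
    rw [lintegral_const_mul _ (measurable_ennnormSq Ψ.contDiff.continuous), Ψ.norm_eq, mul_one]
  rw [periodicEnergy, eq_top_iff, ← h1]
  exact setLIntegral_mono' (measurableSet_cellN N L) hpt

/-- Hence `E₀^per(N, L) = ⊤` for the hard-sphere gas as soon as `N > ⌈2L/a⌉³`. [folklore] -/
theorem periodicGroundStateEnergy_hardCorePotential_eq_top {a : ℝ} (ha : 0 < a) {L : ℝ} {N : ℕ}
    (hN : ⌈2 * L / a⌉₊ ^ 3 < N) :
    periodicGroundStateEnergy (hardCorePotential a) N L = ⊤ := by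
  rw [periodicGroundStateEnergy, iInf_eq_top]
  exact fun Ψ => periodicEnergy_hardCorePotential_eq_top ha hN Ψ

/-- Above `8/a³` the periodic hard-sphere ground-state energy on the thermodynamic torus
`L_N = (N/ρ)^{1/3}` is eventually `⊤`, so EVERY periodic trial state is a `δ`-near-minimiser
for every `δ`. [folklore] -/
theorem eventually_periodicGroundStateEnergy_hardCorePotential_eq_top {a : ℝ} (ha : 0 < a)
    {ρ : ℝ} (hρ : 8 / a ^ 3 < ρ) :
    ∀ᶠ N : ℕ in atTop,
      periodicGroundStateEnergy (hardCorePotential a) N (sideLength ρ N) = ⊤ := by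
  filter_upwards [eventually_ceil_sideLength_pow_lt ha hρ] with N hN
  exact periodicGroundStateEnergy_hardCorePotential_eq_top ha hN

/-! ## The density threshold of the consequent is genuinely `v`-dependent -/

/-- **Tightness of the quantifier order `∀ v ∃ ρ₀`.** Any density threshold `ρ₀` witnessing the
consequent `ConsequentAt (hardCorePotential a)` satisfies `ρ₀ ≤ 8/a³`: above `8/a³` the torus
energy is `⊤` eventually, every state is a near-minimiser, and the fragmented cat states of
`exists_fragmented_periodicTrialState` have `n₀ ≤ N/m³` for every `m`. [folklore] -/
theorem threshold_le_of_consequentAt_hardCorePotential {a : ℝ} (ha : 0 < a) {ρ₀ : ℝ}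
    (h : ∀ ρ : ℝ, 0 < ρ → ρ < ρ₀ → ∃ c : ℝ, 0 < c ∧ ∀ᶠ N : ℕ in atTop,
      ∃ δ : ℝ≥0∞, 0 < δ ∧ ∀ Ψ : PeriodicTrialState N (sideLength ρ N),
        periodicEnergy (hardCorePotential a) Ψ ≤
            periodicGroundStateEnergy (hardCorePotential a) N (sideLength ρ N) + δ →
          ENNReal.ofReal (c * N) ≤ condensateOccupation N (sideLength ρ N) Ψ.ψ) :
    ρ₀ ≤ 8 / a ^ 3 := by
  by_contra hlt
  push Not at hlt
  -- a density strictly between `8/a³` and `ρ₀`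
  set ρ : ℝ := (8 / a ^ 3 + ρ₀) / 2 with hρdef
  have h8 : (0 : ℝ) < 8 / a ^ 3 := by positivity
  have hρ8 : 8 / a ^ 3 < ρ := by rw [hρdef]; linarith
  have hρ0 : 0 < ρ := h8.trans hρ8
  have hρρ₀ : ρ < ρ₀ := by rw [hρdef]; linarith
  obtain ⟨c, hc, hev⟩ := h ρ hρ0 hρρ₀
  obtain ⟨N, ⟨δ, hδ, hΨ⟩, htop, hN2⟩ :=
    (hev.and ((eventually_periodicGroundStateEnergy_hardCorePotential_eq_top ha hρ8).and
      (eventually_ge_atTop 2))).exists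
  have hNpos : 0 < N := by omega
  have hL : 0 < sideLength ρ N := sideLength_pos_of_pos hρ0 hNpos
  -- an integer `m` with `1/m³ < c`
  obtain ⟨m, hm⟩ := exists_nat_gt (1 / c)
  have hmpos : 0 < m := by
    have : (0 : ℝ) < m := (by positivity : (0 : ℝ) < 1 / c).trans hm
    exact_mod_cast this
  obtain ⟨Φ, -, -, hocc⟩ := exists_fragmented_periodicTrialState (L := sideLength ρ N) hmpos hN2 hL
  have hwin : periodicEnergy (hardCorePotential a) Φ ≤
      periodicGroundStateEnergy (hardCorePotential a) N (sideLength ρ N) + δ := by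
    rw [htop, top_add]; exact le_top
  have hcm : c ≤ 1 / m ^ 3 := le_inv_pow_of_ofReal_mul_le hNpos hmpos ((hΨ Φ hwin).trans hocc)
  -- but `1/m³ ≤ 1/m < c`
  have hm1 : (1 : ℝ) ≤ m := by exact_mod_cast hmpos
  have hmc : 1 / (m : ℝ) < c := by
    rw [div_lt_iff₀ (by positivity)]
    rw [div_lt_iff₀ hc] at hm
    linarith
  have : 1 / (m : ℝ) ^ 3 ≤ 1 / (m : ℝ) := by
    apply div_le_div_of_nonneg_left zero_le_one (by positivity)
    calc (m : ℝ) = m ^ 1 := (pow_one _).symm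
      _ ≤ m ^ 3 := pow_le_pow_right₀ hm1 (by norm_num)
  linarith

/-- **No `v`-uniform density threshold**: the consequent with `∃ ρ₀` BEFORE `∀ v` is false — hard spheres of radius
`a = L_{64}(ρ₀/2) = (128/ρ₀)^{1/3}` (so that `8/a³ = ρ₀/16 < ρ₀/2`) refute it. By scaling
(`v_R(r) = R⁻² v(r/R)` has scattering length `R·a(v)`) the threshold must scale like `R₀(v)⁻³`
anyway; the formal witness is the super-close-packed hard-sphere gas, where `E₀^per = ⊤`.
[folklore] -/
theorem not_uniformConsequent :
    ¬ (∃ ρ₀ : ℝ, 0 < ρ₀ ∧ ∀ v : ℝ → ℝ≥0∞, IsRepulsiveFiniteRange v →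
      ∀ ρ : ℝ, 0 < ρ → ρ < ρ₀ → ∃ c : ℝ, 0 < c ∧ ∀ᶠ N : ℕ in atTop,
        ∃ δ : ℝ≥0∞, 0 < δ ∧ ∀ Ψ : PeriodicTrialState N (sideLength ρ N),
          periodicEnergy v Ψ ≤ periodicGroundStateEnergy v N (sideLength ρ N) + δ →
            ENNReal.ofReal (c * N) ≤ condensateOccupation N (sideLength ρ N) Ψ.ψ) := by
  rintro ⟨ρ₀, hρ₀, h⟩
  -- radius with `a³ = 128/ρ₀`
  set a : ℝ := sideLength (ρ₀ / 2) 64 with hadef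
  have hρ2 : 0 < ρ₀ / 2 := by positivity
  have ha : 0 < a := sideLength_pos_of_pos hρ2 (by norm_num)
  have ha3 : a ^ 3 = 64 / (ρ₀ / 2) := by
    rw [hadef, sideLength_pow_three hρ2]; norm_num
  have hle := threshold_le_of_consequentAt_hardCorePotential ha
    (h (hardCorePotential a) (isRepulsiveFiniteRange_hardCorePotential a))
  rw [ha3] at hle
  have : (8 : ℝ) / (64 / (ρ₀ / 2)) = ρ₀ / 16 := by field_simp; ring
  rw [this] at hle
  linarith

/-- **Uniform-threshold bridge ↔ ¬(lattice target).** The natural strengthening of the crux in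
which the consequent's density threshold is chosen before the potential holds iff the route's own
target `KineticLatticeBEC` fails. [folklore] -/
theorem bridgeUniform_iff_not_kinetic :
    (KineticLatticeBEC →
      (∃ ρ₀ : ℝ, 0 < ρ₀ ∧ ∀ v : ℝ → ℝ≥0∞, IsRepulsiveFiniteRange v →
        ∀ ρ : ℝ, 0 < ρ → ρ < ρ₀ → ∃ c : ℝ, 0 < c ∧ ∀ᶠ N : ℕ in atTop,
          ∃ δ : ℝ≥0∞, 0 < δ ∧ ∀ Ψ : PeriodicTrialState N (sideLength ρ N),
            periodicEnergy v Ψ ≤ periodicGroundStateEnergy v N (sideLength ρ N) + δ →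
              ENNReal.ofReal (c * N) ≤ condensateOccupation N (sideLength ρ N) Ψ.ψ)) ↔
      ¬ KineticLatticeBEC :=
  ⟨fun h hA => not_uniformConsequent (h hA), fun h hA => absurd hA h⟩

end Summit.AtomisticToContinuum.BoseEinsteinCondensation.Theorems.LatticeToPeriodicBridge.Negative

end
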